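import Literature.NumberTheory.EllipticCurves.ModularCurveEtaQuotientsProofs
import Literature.NumberTheory.EllipticCurves.KleinJIntegralQExpansion
import HarnessLib

/-!
# `q`-expansions of `η`-quotients are integer unit series

For an exponent vector `r` at level `N` with `Σ_{δ ∣ N} δ r_δ = 0` the `η`-quotient
`f(τ) = ∏_{δ ∣ N} η(δτ)^{r_δ}` (`etaQuotient N r` of `ModularCurveEtaQuotientsProofs`) is the
`1`-periodic holomorphic function

  `f(τ) = ∏_{δ ∣ N} ∏_{n ≥ 1} (1 - q^{δ n})^{r_δ}`,  `q = e^{2πiτ}`,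

and we PROVE that Mathlib's analytic `q`-expansion `qExpansion 1 f` (Taylor series of the cusp
function) is the image of an INTEGER power series with constant term `1`
(`exists_int_map_eq_qExpansion_etaQuotient`), i.e. `f ∈ 1 + qℤ⟦q⟧` is a unit of `ℤ⟦q⟧` — the input
needed to divide cusp forms with integral Fourier coefficients by `f` without leaving `ℤ⟦q⟧`
(Deligne–Serre 1974, proof of Prop. 2.7 / Rem. 2.8-style weight reduction with `η`-quotient
multipliers, `DeligneSerreProp27WeightOneDescentProofs`).  `ModularCurveEtaQuotientsProofs`
constructs the `η`-quotients and their behaviour at all cusps but computes no `q`-expansion.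

## Contents (all proved; the definitions are concrete integer series / functions)

* `eulerTrunc s N = ∏_{m<N} (1 - X^{m+1})^s`, `formalEulerPow s = ∏_{n≥1} (1 - Xⁿ)^s ∈ ℤ⟦X⟧`
  (coefficientwise limit, `coeff_formalEulerPow`), and
  **`hasSum_formalEulerPow`: `∏_{n≥1}(1 - qⁿ)^s = Σ aₙ qⁿ` on the unit disc** — the argument of
  `hasSum_formalDeltaUnit` (`KleinJIntegralQExpansion`, the case `s = 24`) for every `s`: the
  truncated products converge locally uniformly (Mathlib
  `ModularForm.multipliableLocallyUniformlyOn_one_sub_pow`), hence so do all derivatives, and the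
  Taylor coefficients of the truncations stabilise.
* `eulerFn δ τ = ∏_{n≥1} (1 - q^{δ n})`, its `q`-series `hasSum_eulerFn` with the integer
  coefficients `formalEulerScaled δ`, and `eta_natMul_eq_qParam_mul_eulerFn`:
  `η(δτ) = e^{2πiδτ/24} · eulerFn δ τ`.
* `IsIntUnitQExp f`: `f` is `1`-periodic, holomorphic, bounded at `i∞` with `qExpansion 1 f` the
  image of an integer series with constant term `1`; closed under products, powers, inverses of
  zero-free functions and integer powers (`IsIntUnitQExp.mul/pow/inv/zpow/prod`), using Mathlib's
  `qExpansion_mul`, `qExpansion_one`, `qExpansion_coeff_unique`; such an `f` tends to `1` at `i∞`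
  (`IsIntUnitQExp.tendsto_one`).
* `etaQuotient_eq_prod_eulerFn_zpow` (`Σ δ r_δ = 0`), **`isIntUnitQExp_etaQuotient`** and
  **`exists_int_map_eq_qExpansion_etaQuotient`**.

## References

* T. M. Apostol, *Modular functions and Dirichlet series in number theory*, GTM 41, §3.1–3.2
  (`η(τ) = e^{πiτ/12} ∏ (1 - e^{2πinτ})`; integrality of product expansions).
* G. Köhler, *Eta products and theta series identities*, Springer 2011, §1.1, §2.1 (eta quotients,
  their `q`-expansions in `ℤ⟦q⟧`).
* P. Deligne, J.-P. Serre, *Formes modulaires de poids 1*, Ann. Sci. ÉNS 7 (1974), Rem. 2.8.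
-/

noncomputable section

open Filter Topology Complex PowerSeries
open UpperHalfPlane hiding I
open scoped Real MatrixGroups Manifold ModularForm

namespace Literature.NumberTheory.EllipticCurves.ModularForms

/-! ### 1. The integer series `∏_{n ≥ 1} (1 - Xⁿ)^s` -/

/-- The truncated product `∏_{m < N} (1 - X^{m+1})^s ∈ ℤ⟦X⟧` (a polynomial); for `s = 24` this is
the tree's `deltaFactorProd N` (`TateSeriesFormal`, see `eulerTrunc_twentyFour`). [folklore] -/
def eulerTrunc (s N : ℕ) : PowerSeries ℤ :=
  ∏ m ∈ Finset.range N, (1 - (X : PowerSeries ℤ) ^ (m + 1)) ^ s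

/-- `eulerTrunc 24 = deltaFactorProd` (`TateSeriesFormal`), definitionally. [folklore] -/
theorem eulerTrunc_twentyFour (N : ℕ) : eulerTrunc 24 N = deltaFactorProd N := rfl

/-- `(1 - X^k)^s ≡ 1 (mod X^k)`. [folklore] -/
theorem exists_one_sub_X_pow_pow_eq_one_add (k s : ℕ) :
    ∃ R : PowerSeries ℤ, (1 - (X : PowerSeries ℤ) ^ k) ^ s = 1 + X ^ k * R := by
  obtain ⟨R, hR⟩ := sub_dvd_pow_sub_pow (1 - (X : PowerSeries ℤ) ^ k) 1 s
  refine ⟨-R, ?_⟩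
  rw [one_pow, sub_sub_cancel_left] at hR
  linear_combination hR

/-- Multiplying by `(1 - X^k)^s` does not change coefficients below `X^k`. [folklore] -/
theorem coeff_mul_one_sub_X_pow_pow_of_lt {n k : ℕ} (h : n < k) (s : ℕ) (φ : PowerSeries ℤ) :
    coeff n (φ * (1 - X ^ k) ^ s) = coeff n φ := by
  obtain ⟨R, hR⟩ := exists_one_sub_X_pow_pow_eq_one_add k s
  rw [hR, mul_add, mul_one, map_add, mul_left_comm, coeff_X_pow_mul', if_neg (not_le.mpr h),
    add_zero]

/-- The coefficients of the truncated products stabilise. [folklore] -/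
theorem coeff_eulerTrunc_of_le {s n N : ℕ} (h : n ≤ N) :
    coeff n (eulerTrunc s N) = coeff n (eulerTrunc s n) := by
  induction N, h using Nat.le_induction with
  | base => rfl
  | succ N hnN ih =>
    rw [eulerTrunc, Finset.prod_range_succ, ← eulerTrunc,
      coeff_mul_one_sub_X_pow_pow_of_lt (Nat.lt_succ_of_le hnN), ih]

/-- **`∏_{n ≥ 1} (1 - Xⁿ)^s ∈ ℤ⟦X⟧`** as an integer formal power series: its `n`-th coefficient is
that of any long enough truncated product.  For `s = 24` this is the tree's `formalDeltaUnit`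
(`Δ/q`, `TateSeriesFormal`), definitionally (`formalEulerPow_twentyFour`), so that
`hasSum_formalEulerPow` below generalises `hasSum_formalDeltaUnit` of `KleinJIntegralQExpansion`.
[folklore] -/
def formalEulerPow (s : ℕ) : PowerSeries ℤ :=
  PowerSeries.mk fun n ↦ coeff n (eulerTrunc s n)

/-- `formalEulerPow 24 = formalDeltaUnit` (`TateSeriesFormal`), definitionally. [folklore] -/
theorem formalEulerPow_twentyFour : formalEulerPow 24 = formalDeltaUnit := rfl

/-- The `n`-th coefficient of `∏ (1 - Xⁿ)^s` is that of `∏_{m<N} (1 - X^{m+1})^s` for `N ≥ n`.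
[folklore] -/
theorem coeff_formalEulerPow {s n N : ℕ} (h : n ≤ N) :
    coeff n (formalEulerPow s) = coeff n (eulerTrunc s N) := by
  rw [formalEulerPow, coeff_mk, coeff_eulerTrunc_of_le h]

/-- `∏ (1 - Xⁿ)^s` has constant term `1`. [folklore] -/
@[simp]
theorem constantCoeff_formalEulerPow (s : ℕ) : constantCoeff (formalEulerPow s) = 1 := by
  rw [← coeff_zero_eq_constantCoeff_apply, coeff_formalEulerPow (le_refl 0), eulerTrunc,
    Finset.range_zero, Finset.prod_empty, coeff_zero_eq_constantCoeff_apply, map_one]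

/-! ### 2. `∏_{n ≥ 1} (1 - qⁿ)^s = Σ aₙ qⁿ` on the unit disc -/

/-- The truncated products `∏_{n<N} (1 − q^{n+1})^s` converge to `∏_{n ≥ 1} (1 − qⁿ)^s` locally
uniformly on the unit disc. [folklore] -/
theorem tendstoLocallyUniformlyOn_prod_one_sub_pow_pow' (s : ℕ) :
    TendstoLocallyUniformlyOn (fun N q ↦ ∏ n ∈ Finset.range N, (1 - q ^ (n + 1)) ^ s)
      (fun q : ℂ ↦ ∏' n, (1 - q ^ (n + 1)) ^ s) atTop (Metric.ball 0 1) := by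
  have h1 : TendstoLocallyUniformlyOn (fun N q ↦ ∏ n ∈ Finset.range N, (1 - q ^ (n + 1)))
      (fun q : ℂ ↦ ∏' n, (1 - q ^ (n + 1))) atTop (Metric.ball 0 1) := by
    have := (hasProdLocallyUniformlyOn_iff_tendstoLocallyUniformlyOn.mp
      ModularForm.multipliableLocallyUniformlyOn_one_sub_pow.hasProdLocallyUniformlyOn)
    exact this.comp_tendsto_index tendsto_finset_range
  have h2 := h1.pow_of_continuousOn ModularForm.differentiableOn_tprod_one_sub_pow.continuousOn s
  refine (h2.congr fun N q _ ↦ ?_).congr_right fun q hq ↦ ?_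
  · simp [Finset.prod_pow]
  · exact ((ModularForm.multipliable_one_sub_pow (by simpa using hq)).tprod_pow s).symm

/-- The truncated product as a polynomial function. [folklore] -/
theorem prod_one_sub_pow_pow_eq_eval' (s N : ℕ) (q : ℂ) :
    ∏ n ∈ Finset.range N, (1 - q ^ (n + 1)) ^ s =
      (∏ n ∈ Finset.range N, (1 - Polynomial.X ^ (n + 1)) ^ s : Polynomial ℂ).eval q := by
  simp [Polynomial.eval_prod]

/-- The coefficients of the complex polynomial `∏_{n<N} (1 − X^{n+1})^s` are those of the integer
series `eulerTrunc s N`. [folklore] -/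
theorem coeff_prod_one_sub_X_pow_pow' (s N k : ℕ) :
    (∏ n ∈ Finset.range N, (1 - Polynomial.X ^ (n + 1)) ^ s : Polynomial ℂ).coeff k =
      ((coeff k (eulerTrunc s N) : ℤ) : ℂ) := by
  have h1 : ((∏ n ∈ Finset.range N, (1 - Polynomial.X ^ (n + 1)) ^ s : Polynomial ℂ) :
      PowerSeries ℂ) = (eulerTrunc s N).map (Int.castRingHom ℂ) := by
    rw [eulerTrunc, map_prod, ← Polynomial.coeToPowerSeries.ringHom_apply, map_prod]
    refine Finset.prod_congr rfl fun n _ ↦ ?_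
    simp [Polynomial.coeToPowerSeries.ringHom_apply, Polynomial.coe_sub, Polynomial.coe_pow]
  rw [← Polynomial.coeff_coe, h1, coeff_map, Int.coe_castRingHom]

/-- **The Taylor coefficients of `∏ (1 − qⁿ)^s` at `q = 0` are the integers `formalEulerPow s`.**
[folklore] -/
theorem iteratedDeriv_tprod_one_sub_pow_pow_zero' (s k : ℕ) :
    iteratedDeriv k (fun q : ℂ ↦ ∏' n, (1 - q ^ (n + 1)) ^ s) 0 =
      (k.factorial : ℂ) * ((coeff k (formalEulerPow s) : ℤ) : ℂ) := by
  have hlim :=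
    (((tendstoLocallyUniformlyOn_prod_one_sub_pow_pow' s).iteratedDeriv_of_differentiableOn
      (fun N ↦ ?_) Metric.isOpen_ball k).tendsto_at (Metric.mem_ball_self one_pos))
  · refine tendsto_nhds_unique hlim (tendsto_const_nhds.congr' ?_)
    filter_upwards [Filter.eventually_ge_atTop k] with N hN
    have : (fun q : ℂ ↦ ∏ n ∈ Finset.range N, (1 - q ^ (n + 1)) ^ s) =
        fun q ↦ (∏ n ∈ Finset.range N, (1 - Polynomial.X ^ (n + 1)) ^ s : Polynomial ℂ).eval q :=
      funext (prod_one_sub_pow_pow_eq_eval' s N)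
    rw [this, iteratedDeriv_polynomial_eval_zero, coeff_prod_one_sub_X_pow_pow',
      ← coeff_formalEulerPow hN]
  · have : (fun q : ℂ ↦ ∏ n ∈ Finset.range N, (1 - q ^ (n + 1)) ^ s) =
        fun q ↦ (∏ n ∈ Finset.range N, (1 - Polynomial.X ^ (n + 1)) ^ s : Polynomial ℂ).eval q :=
      funext (prod_one_sub_pow_pow_eq_eval' s N)
    rw [this]
    exact (Polynomial.differentiable _).differentiableOn

/-- **`∏_{n ≥ 1} (1 − qⁿ)^s = Σₙ aₙ qⁿ` on the unit disc, `a = formalEulerPow s ∈ ℤ⟦q⟧`.**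
[folklore] -/
theorem hasSum_formalEulerPow (s : ℕ) {q : ℂ} (hq : ‖q‖ < 1) :
    HasSum (fun n ↦ ((coeff n (formalEulerPow s) : ℤ) : ℂ) * q ^ n)
      (∏' n, (1 - q ^ (n + 1)) ^ s) := by
  have h := Complex.hasSum_taylorSeries_on_ball
    (ModularForm.differentiableOn_tprod_one_sub_pow_pow s) (mem_ball_zero_iff.mpr hq)
  refine h.congr_fun fun n ↦ ?_
  rw [iteratedDeriv_tprod_one_sub_pow_pow_zero', sub_zero, smul_eq_mul, smul_eq_mul]
  have : (n.factorial : ℂ) ≠ 0 := by exact_mod_cast n.factorial_ne_zero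
  field_simp

/-! ### 3. The functions `∏_{n ≥ 1} (1 - q^{δ n})` on `ℍ` and their `q`-series -/

/-- `eulerFn δ τ = ∏_{n ≥ 1} (1 - q^{δ n})`, `q = e^{2πiτ}` (the "`q`-product part" of `η(δτ)`).
[folklore] -/
def eulerFn (δ : ℕ) (τ : ℍ) : ℂ :=
  ∏' n : ℕ, (1 - (Function.Periodic.qParam 1 (τ : ℂ) ^ δ) ^ (n + 1))

/-- `q(δ z) = q(z)^δ` for `q = e^{2πiz}`. [folklore] -/
theorem qParam_one_natCast_mul (δ : ℕ) (z : ℂ) :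
    Function.Periodic.qParam 1 ((δ : ℂ) * z) = Function.Periodic.qParam 1 z ^ δ := by
  simp only [Function.Periodic.qParam, Complex.ofReal_one, div_one, ← Complex.exp_nat_mul]
  congr 1
  ring

/-- `q(z + 1) = q(z)`. [folklore] -/
theorem qParam_one_add_one (z : ℂ) :
    Function.Periodic.qParam 1 (z + 1) = Function.Periodic.qParam 1 z := by
  simp only [Function.Periodic.qParam, Complex.ofReal_one, div_one, mul_add, mul_one,
    Complex.exp_add, Complex.exp_two_pi_mul_I]

/-- **`η(δτ) = e^{2πiδτ/24} · ∏ (1 - q^{δn})`.** [folklore] -/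
theorem eta_natMul_eq_qParam_mul_eulerFn (δ : ℕ) (τ : ℍ) :
    η ((δ : ℂ) * τ) = Function.Periodic.qParam 24 ((δ : ℂ) * τ) * eulerFn δ τ := by
  rw [ModularForm.eta, eulerFn]
  congr 1
  refine tprod_congr fun n ↦ ?_
  rw [ModularForm.eta_q, qParam_one_natCast_mul]

/-- The integer coefficients of `∏_{n≥1} (1 - q^{δn})` as a series in `q`: the coefficients of
`formalEulerPow 1` spread out to the multiples of `δ`. [folklore] -/
def formalEulerScaled (δ : ℕ) : PowerSeries ℤ :=
  PowerSeries.mk fun m ↦ if δ ∣ m then coeff (m / δ) (formalEulerPow 1) else 0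

/-- Coefficients of `formalEulerScaled`. [folklore] -/
theorem coeff_formalEulerScaled (δ m : ℕ) :
    coeff m (formalEulerScaled δ) = if δ ∣ m then coeff (m / δ) (formalEulerPow 1) else 0 :=
  coeff_mk _ _

/-- `formalEulerScaled δ` has constant term `1`. [folklore] -/
@[simp]
theorem constantCoeff_formalEulerScaled (δ : ℕ) : constantCoeff (formalEulerScaled δ) = 1 := by
  rw [← coeff_zero_eq_constantCoeff_apply, coeff_formalEulerScaled, if_pos (dvd_zero δ),
    Nat.zero_div, coeff_zero_eq_constantCoeff_apply, constantCoeff_formalEulerPow]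

/-- **The `q`-series of `∏ (1 - q^{δn})` on `ℍ`** (`δ ≥ 1`):
`∏_{n≥1} (1 - q^{δn}) = Σₘ cₘ qᵐ` with `c = formalEulerScaled δ ∈ ℤ⟦q⟧`. [folklore] -/
theorem hasSum_eulerFn {δ : ℕ} (hδ : 0 < δ) (τ : ℍ) :
    HasSum (fun m ↦
      ((coeff m (formalEulerScaled δ) : ℤ) : ℂ) • Function.Periodic.qParam 1 (τ : ℂ) ^ m)
      (eulerFn δ τ) := by
  have hq : ‖Function.Periodic.qParam 1 (τ : ℂ) ^ δ‖ < 1 := by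
    rw [norm_pow]
    exact pow_lt_one₀ (norm_nonneg _) (Function.Periodic.norm_qParam_lt_one one_pos τ.im_pos)
      hδ.ne'
  have h1 := hasSum_formalEulerPow 1 hq
  simp only [pow_one] at h1
  rw [← (mul_right_injective₀ hδ.ne').hasSum_iff (f := fun m ↦
    ((coeff m (formalEulerScaled δ) : ℤ) : ℂ) • Function.Periodic.qParam 1 (τ : ℂ) ^ m)
    (a := eulerFn δ τ) ?_]
  · refine (show HasSum _ (eulerFn δ τ) from h1).congr_fun fun n ↦ ?_
    simp only [Function.comp_apply, coeff_formalEulerScaled, smul_eq_mul,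
      if_pos (dvd_mul_right δ n), Nat.mul_div_cancel_left n hδ, pow_mul]
  · intro m hm
    have hnd : ¬ δ ∣ m := fun ⟨c, hc⟩ ↦ hm ⟨c, hc.symm⟩
    simp [coeff_formalEulerScaled, hnd]

/-- `∏ (1 - q^{δn})` is `1`-periodic. [folklore] -/
theorem periodic_eulerFn (δ : ℕ) : Function.Periodic (eulerFn δ ∘ ofComplex) 1 := by
  intro z
  by_cases hz : 0 < z.im
  · have hz' : 0 < (z + 1).im := by simpa using hz
    simp only [Function.comp_apply, ofComplex_apply_of_im_pos hz, ofComplex_apply_of_im_pos hz',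
      eulerFn, UpperHalfPlane.coe_mk, qParam_one_add_one]
  · have h1 : z.im ≤ 0 := not_lt.mp hz
    have h2 : (z + 1).im ≤ 0 := by simpa using h1
    simp only [Function.comp_apply, ofComplex_apply_of_im_nonpos h1,
      ofComplex_apply_of_im_nonpos h2]

/-- `∏ (1 - q^{δn})` is holomorphic on `ℍ`. [folklore] -/
theorem mdifferentiable_eulerFn (δ : ℕ) : MDiff (eulerFn δ) := by
  rw [UpperHalfPlane.mdifferentiable_iff]
  rcases Nat.eq_zero_or_pos δ with rfl | hδ
  · -- `δ = 0`: the function is constant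
    refine (differentiableOn_const (∏' n : ℕ, (1 - (1 : ℂ) ^ (n + 1)))).congr fun z hz ↦ ?_
    rw [Function.comp_apply, ofComplex_apply_of_im_pos hz, eulerFn]
    simp
  have hq : DifferentiableOn ℂ (fun z : ℂ ↦ Function.Periodic.qParam 1 z ^ δ) {z : ℂ | 0 < z.im} :=
    ((Function.Periodic.differentiable_qParam (h := 1)).pow δ).differentiableOn
  have hmaps : Set.MapsTo (fun z : ℂ ↦ Function.Periodic.qParam 1 z ^ δ) {z : ℂ | 0 < z.im}
      (Metric.ball 0 1) := by
    intro z hz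
    rw [Metric.mem_ball, dist_zero_right, norm_pow]
    exact pow_lt_one₀ (norm_nonneg _) (Function.Periodic.norm_qParam_lt_one one_pos hz) hδ.ne'
  refine (ModularForm.differentiableOn_tprod_one_sub_pow.comp hq hmaps).congr fun z hz ↦ ?_
  rw [Function.comp_apply, ofComplex_apply_of_im_pos hz, eulerFn]
  rfl

/-- **`q`-expansion principle for plain functions**: if a `1`-periodic holomorphic `f` bounded at
`i∞` is the sum of a `q`-series `Σ cₘ qᵐ` on `ℍ`, then `qExpansion 1 f` has coefficients `c`
(Mathlib's `qExpansion_coeff_unique` is stated for bundled `FunLike` types; this is the version for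
`f : ℍ → ℂ`, via `hasFPowerSeriesOnBall_cuspFunction`; cf. `qExpansion_coeff_eq_of_hasSum` of
`CuspFunctionDerivativeProofs`, not imported here). [folklore] -/
theorem qExpansion_one_coeff_eq_of_hasSum {f : ℍ → ℂ} {c : ℕ → ℂ}
    (hper : Function.Periodic (f ∘ ofComplex) 1) (hmd : MDiff f) (hbd : IsBoundedAtImInfty f)
    (hf : ∀ τ : ℍ, HasSum (fun m ↦ c m • Function.Periodic.qParam 1 (τ : ℂ) ^ m) (f τ)) (m : ℕ) :
    (qExpansion 1 f).coeff m = c m := by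
  have han := analyticAt_cuspFunction_zero one_pos hper hmd hbd
  have h := UpperHalfPlane.hasFPowerSeriesOnBall_cuspFunction one_pos han hf
  have h' := UpperHalfPlane.hasFPowerSeriesOnBall_cuspFunction one_pos han
    (fun τ ↦ hasSum_qExpansion one_pos hper hmd hbd τ)
  have := congr_arg (FormalMultilinearSeries.coeff · m)
    (h'.hasFPowerSeriesAt.eq_formalMultilinearSeries h.hasFPowerSeriesAt)
  simpa only [FormalMultilinearSeries.coeff_ofScalars] using this

/-- `∏ (1 - q^{δn})` is bounded at `i∞` (`δ ≥ 1`). [folklore] -/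
theorem isBoundedAtImInfty_eulerFn {δ : ℕ} (hδ : 0 < δ) : IsBoundedAtImInfty (eulerFn δ) :=
  UpperHalfPlane.isBoundedAtImInfty_of_hasSum_qExpansion one_pos (hasSum_eulerFn hδ)

/-! ### 4. Functions with integral unit `q`-expansion -/

/-- A function `f : ℍ → ℂ` **has an integral unit `q`-expansion**: it is `1`-periodic, holomorphic
and bounded at `i∞` (so that Mathlib's `qExpansion 1 f` is its convergent `q`-series), and
`qExpansion 1 f` is the image of an integer power series with constant term `1` (a unit of `ℤ⟦q⟧`).
[folklore] -/
structure IsIntUnitQExp (f : ℍ → ℂ) : Prop where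
  /-- `f(τ + 1) = f(τ)` -/
  periodic : Function.Periodic (f ∘ ofComplex) 1
  /-- `f` is holomorphic on `ℍ` -/
  mdiff : MDiff f
  /-- `f` is bounded at `i∞` -/
  bdd : IsBoundedAtImInfty f
  /-- `qExpansion 1 f ∈ 1 + qℤ⟦q⟧` -/
  exists_int : ∃ P : PowerSeries ℤ,
    constantCoeff P = 1 ∧ P.map (Int.castRingHom ℂ) = qExpansion 1 f

namespace IsIntUnitQExp

variable {f g : ℍ → ℂ}

/-- The cusp function of such an `f` is analytic at `q = 0`. [folklore] -/
theorem analyticAt (hf : IsIntUnitQExp f) : AnalyticAt ℂ (cuspFunction 1 f) 0 :=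
  analyticAt_cuspFunction_zero one_pos hf.periodic hf.mdiff hf.bdd

/-- The constant term of the `q`-expansion is `1`. [folklore] -/
theorem coeff_zero (hf : IsIntUnitQExp f) : (qExpansion 1 f).coeff 0 = 1 := by
  obtain ⟨P, hP1, hP⟩ := hf.exists_int
  rw [← hP, coeff_map, coeff_zero_eq_constantCoeff_apply, hP1, map_one]

/-- Such an `f` tends to `1` at `i∞`. [folklore] -/
theorem tendsto_one (hf : IsIntUnitQExp f) : Tendsto f atImInfty (𝓝 1) := by
  have h := hf.analyticAt.continuousAt.tendsto.comp (qParam_tendsto_atImInfty one_pos)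
  have hval : cuspFunction 1 f 0 = 1 := by
    have := qExpansion_coeff f (h := 1) 0
    rw [hf.coeff_zero, Nat.factorial_zero, Nat.cast_one, inv_one, one_mul,
      iteratedDeriv_zero] at this
    exact this.symm
  rw [hval] at h
  exact h.congr fun τ ↦ by
    simp [Function.comp_apply, UpperHalfPlane.eq_cuspFunction τ one_ne_zero hf.periodic]

/-- The constant function `1`. [folklore] -/
theorem one : IsIntUnitQExp (1 : ℍ → ℂ) where
  periodic := fun _ ↦ rfl
  mdiff := mdifferentiable_const
  bdd := Filter.const_boundedAtFilter _ _
  exists_int := ⟨1, by simp, by rw [map_one, qExpansion_one]⟩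

/-- Products. [folklore] -/
theorem mul (hf : IsIntUnitQExp f) (hg : IsIntUnitQExp g) : IsIntUnitQExp (f * g) where
  periodic := hf.periodic.mul hg.periodic
  mdiff := hf.mdiff.mul hg.mdiff
  bdd := hf.bdd.mul hg.bdd
  exists_int := by
    obtain ⟨P, hP1, hP⟩ := hf.exists_int
    obtain ⟨Q, hQ1, hQ⟩ := hg.exists_int
    refine ⟨P * Q, by rw [map_mul, hP1, hQ1, mul_one], ?_⟩
    rw [map_mul, hP, hQ, qExpansion_mul hf.analyticAt hg.analyticAt]

/-- Natural powers. [folklore] -/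
theorem pow (hf : IsIntUnitQExp f) (n : ℕ) : IsIntUnitQExp (f ^ n) := by
  induction n with
  | zero => rw [pow_zero]; exact one
  | succ n ih => rw [pow_succ]; exact ih.mul hf

/-- Inverses of zero-free functions. [folklore] -/
theorem inv (hf : IsIntUnitQExp f) (hne : ∀ τ : ℍ, f τ ≠ 0) : IsIntUnitQExp f⁻¹ := by
  have hper : Function.Periodic (f⁻¹ ∘ ofComplex) 1 := fun z ↦ by
    have := hf.periodic z
    simp only [Function.comp_apply, Pi.inv_apply] at this ⊢
    rw [this]
  have hmd : MDiff f⁻¹ := by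
    have h := hf.mdiff
    rw [UpperHalfPlane.mdifferentiable_iff] at h ⊢
    exact (h.inv fun z _ ↦ hne _).congr fun z _ ↦ by simp
  have hbd : IsBoundedAtImInfty f⁻¹ := by
    have := hf.tendsto_one.inv₀ one_ne_zero
    rw [inv_one] at this
    exact this.isBigO_one ℝ
  refine ⟨hper, hmd, hbd, ?_⟩
  obtain ⟨P, hP1, hP⟩ := hf.exists_int
  have hu : IsUnit P := PowerSeries.isUnit_iff_constantCoeff.mpr (hP1 ▸ isUnit_one)
  obtain ⟨u, rfl⟩ := hu
  refine ⟨↑u⁻¹, ?_, ?_⟩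
  · have h := congrArg constantCoeff u.inv_mul
    rw [map_mul, map_one, hP1, mul_one] at h
    exact h
  · have han : AnalyticAt ℂ (cuspFunction 1 f⁻¹) 0 :=
      analyticAt_cuspFunction_zero one_pos hper hmd hbd
    have hfun : f⁻¹ * f = 1 := funext fun τ ↦ inv_mul_cancel₀ (hne τ)
    have key : qExpansion 1 f⁻¹ * qExpansion 1 f = 1 := by
      rw [← qExpansion_mul han hf.analyticAt, hfun, qExpansion_one]
    have hPQ : (↑u : PowerSeries ℤ).map (Int.castRingHom ℂ) *
        (↑u⁻¹ : PowerSeries ℤ).map (Int.castRingHom ℂ) = 1 := by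
      rw [← map_mul, u.mul_inv, map_one]
    calc (↑u⁻¹ : PowerSeries ℤ).map (Int.castRingHom ℂ)
        = (qExpansion 1 f⁻¹ * qExpansion 1 f) *
            (↑u⁻¹ : PowerSeries ℤ).map (Int.castRingHom ℂ) := by rw [key, one_mul]
      _ = qExpansion 1 f⁻¹ * ((↑u : PowerSeries ℤ).map (Int.castRingHom ℂ) *
            (↑u⁻¹ : PowerSeries ℤ).map (Int.castRingHom ℂ)) := by rw [mul_assoc, ← hP]
      _ = qExpansion 1 f⁻¹ := by rw [hPQ, mul_one]

/-- Integer powers of zero-free functions. [folklore] -/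
theorem zpow (hf : IsIntUnitQExp f) (hne : ∀ τ : ℍ, f τ ≠ 0) (n : ℤ) :
    IsIntUnitQExp (fun τ ↦ f τ ^ n) := by
  cases n with
  | ofNat n =>
    have : (fun τ ↦ f τ ^ (Int.ofNat n)) = f ^ n := by
      funext τ
      simp
    rw [this]
    exact hf.pow n
  | negSucc n =>
    have : (fun τ ↦ f τ ^ (Int.negSucc n)) = (f ^ (n + 1))⁻¹ := by
      funext τ
      simp [zpow_negSucc]
    rw [this]
    exact (hf.pow (n + 1)).inv fun τ ↦ by simpa using pow_ne_zero (n + 1) (hne τ)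

/-- Finite products. [folklore] -/
theorem prod {ι : Type*} (s : Finset ι) {F : ι → ℍ → ℂ} (h : ∀ i ∈ s, IsIntUnitQExp (F i)) :
    IsIntUnitQExp (∏ i ∈ s, F i) := by
  classical
  induction s using Finset.induction_on with
  | empty =>
    rw [Finset.prod_empty]
    exact one
  | insert a s ha ih =>
    rw [Finset.prod_insert ha]
    exact (h a (Finset.mem_insert_self a s)).mul (ih fun i hi ↦ h i (Finset.mem_insert_of_mem hi))

end IsIntUnitQExp

/-- **`∏_{n≥1} (1 - q^{δn})` has an integral unit `q`-expansion** (`δ ≥ 1`), namely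
`formalEulerScaled δ`. [folklore] -/
theorem isIntUnitQExp_eulerFn {δ : ℕ} (hδ : 0 < δ) : IsIntUnitQExp (eulerFn δ) where
  periodic := periodic_eulerFn δ
  mdiff := mdifferentiable_eulerFn δ
  bdd := isBoundedAtImInfty_eulerFn hδ
  exists_int := ⟨formalEulerScaled δ, constantCoeff_formalEulerScaled δ, by
    ext m
    rw [coeff_map, Int.coe_castRingHom]
    exact (qExpansion_one_coeff_eq_of_hasSum (periodic_eulerFn δ) (mdifferentiable_eulerFn δ)
      (isBoundedAtImInfty_eulerFn hδ) (hasSum_eulerFn hδ) m).symm⟩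

/-- `qExpansion 1 (∏ (1 - q^{δn})) = formalEulerScaled δ`. [folklore] -/
theorem qExpansion_eulerFn {δ : ℕ} (hδ : 0 < δ) :
    qExpansion 1 (eulerFn δ) = (formalEulerScaled δ).map (Int.castRingHom ℂ) := by
  ext m
  rw [coeff_map, Int.coe_castRingHom]
  exact qExpansion_one_coeff_eq_of_hasSum (periodic_eulerFn δ) (mdifferentiable_eulerFn δ)
    (isBoundedAtImInfty_eulerFn hδ) (hasSum_eulerFn hδ) m

/-- `eulerFn δ τ = ∏ (1 - eta_q n (δτ))` (Mathlib's factors of `η(δτ)`). [folklore] -/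
theorem eulerFn_eq_tprod_eta_q (δ : ℕ) (τ : ℍ) :
    eulerFn δ τ = ∏' n, (1 - ModularForm.eta_q n ((δ : ℂ) * τ)) := by
  unfold eulerFn
  refine tprod_congr fun n ↦ ?_
  rw [ModularForm.eta_q, qParam_one_natCast_mul]

/-- `∏ (1 - q^{δn}) ≠ 0` on `ℍ` (`δ ≥ 1`). [folklore] -/
theorem eulerFn_ne_zero {δ : ℕ} (hδ : 0 < δ) (τ : ℍ) : eulerFn δ τ ≠ 0 := by
  rw [eulerFn_eq_tprod_eta_q]
  exact ModularForm.eta_tprod_ne_zero (im_natMul_pos hδ τ.2)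

/-! ### 5. `η`-quotients with `Σ δ r_δ = 0` -/

/-- **`∏_δ η(δτ)^{r_δ} = ∏_δ (∏_n (1 - q^{δn}))^{r_δ}` when `Σ δ r_δ = 0`**: the prefactors
`e^{2πiδτ r_δ/24}` multiply to `e^{2πiτ Σδr_δ/24} = 1`. [folklore] -/
theorem etaQuotient_eq_prod_eulerFn_zpow (N : ℕ) (r : ℕ → ℤ)
    (hS : ∑ δ ∈ N.divisors, (δ : ℤ) * r δ = 0) (τ : ℍ) :
    etaQuotient N r τ = ∏ δ ∈ N.divisors, eulerFn δ τ ^ r δ := by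
  rw [etaQuotient_apply]
  simp_rw [eta_natMul_eq_qParam_mul_eulerFn, mul_zpow, Finset.prod_mul_distrib]
  have hq : ∀ δ : ℕ, Function.Periodic.qParam 24 ((δ : ℂ) * τ) ^ (r δ) =
      cexp (2 * π * I * τ / 24 * (((δ : ℤ) * r δ : ℤ) : ℂ)) := fun δ ↦ by
    rw [Function.Periodic.qParam, ← Complex.exp_int_mul]
    congr 1
    push_cast
    ring
  simp_rw [hq]
  rw [← Complex.exp_sum, ← Finset.mul_sum, ← Int.cast_sum, hS, Int.cast_zero, mul_zero,
    Complex.exp_zero, one_mul]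

/-- **`η`-quotients with `Σ δ r_δ = 0` have integral unit `q`-expansions.** [folklore] -/
theorem isIntUnitQExp_etaQuotient (N : ℕ) (r : ℕ → ℤ)
    (hS : ∑ δ ∈ N.divisors, (δ : ℤ) * r δ = 0) : IsIntUnitQExp (etaQuotient N r) := by
  have heq : etaQuotient N r = ∏ δ ∈ N.divisors, fun τ ↦ eulerFn δ τ ^ r δ := by
    funext τ
    rw [etaQuotient_eq_prod_eulerFn_zpow N r hS τ, Finset.prod_apply]
  rw [heq]
  exact IsIntUnitQExp.prod _ fun δ hδ ↦ (isIntUnitQExp_eulerFn (Nat.pos_of_mem_divisors hδ)).zpow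
    (eulerFn_ne_zero (Nat.pos_of_mem_divisors hδ)) (r δ)

/-- **The `q`-expansion of an `η`-quotient with `Σ δ r_δ = 0` lies in `1 + qℤ⟦q⟧`**: it is the image
of an integer power series with constant term `1`. [folklore] -/
theorem exists_int_map_eq_qExpansion_etaQuotient (N : ℕ) (r : ℕ → ℤ)
    (hS : ∑ δ ∈ N.divisors, (δ : ℤ) * r δ = 0) :
    ∃ P : PowerSeries ℤ, constantCoeff P = 1 ∧
      P.map (Int.castRingHom ℂ) = qExpansion 1 (etaQuotient N r) :=
  (isIntUnitQExp_etaQuotient N r hS).exists_int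

/-- Such an `η`-quotient is `1`-periodic (also `etaQuotient_of_coe_eq_add_intCast`). [folklore] -/
theorem periodic_etaQuotient (N : ℕ) (r : ℕ → ℤ) (hS : ∑ δ ∈ N.divisors, (δ : ℤ) * r δ = 0) :
    Function.Periodic (etaQuotient N r ∘ ofComplex) 1 :=
  (isIntUnitQExp_etaQuotient N r hS).periodic

/-- Such an `η`-quotient is bounded at `i∞`; indeed it tends to `1`. [folklore] -/
theorem tendsto_etaQuotient_atImInfty_one (N : ℕ) (r : ℕ → ℤ)
    (hS : ∑ δ ∈ N.divisors, (δ : ℤ) * r δ = 0) :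
    Tendsto (etaQuotient N r) atImInfty (𝓝 1) :=
  (isIntUnitQExp_etaQuotient N r hS).tendsto_one

/-- The `q`-series of such an `η`-quotient converges to it: `f(τ) = Σ aₙ q(τ)ⁿ` with
`a = qExpansion 1 f ∈ ℤ⟦q⟧`. [folklore] -/
theorem hasSum_qExpansion_etaQuotient (N : ℕ) (r : ℕ → ℤ)
    (hS : ∑ δ ∈ N.divisors, (δ : ℤ) * r δ = 0) (τ : ℍ) :
    HasSum (fun m : ℕ ↦
        (qExpansion 1 (etaQuotient N r)).coeff m • Function.Periodic.qParam 1 (τ : ℂ) ^ m)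
      (etaQuotient N r τ) :=
  have h := isIntUnitQExp_etaQuotient N r hS
  hasSum_qExpansion one_pos h.periodic h.mdiff h.bdd τ

end Literature.NumberTheory.EllipticCurves.ModularForms
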